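import Summits.HodgeConjecture.HodgeConjecture.Theorems.NikulinTwinTransportLefschetzOneOneK3Calculus
import Literature.Geometry.Kaehler.ChartTransport
import Literature.NumberTheory.Transcendental.DeRhamTheoremCechProofs

/-!
# Route NikulinTwinTransport — `LefschetzOneOneK3`, `∂∂̄`–exponential line: the local lemmas on chart-convex sets

On a chart set `V = chartSet x₀ C` of an open convex `C` (inside the chart target) of a complex
manifold:

* `hol_add_antihol_of_ddbar_eq_zero` — a function `χ`, smooth on `V` with `∂∂̄χ = 0` on `V`, is
  `G + K` on `V` with `G` holomorphic and `K` antiholomorphic on `V` (the closed `(1,0)`-form `∂χ`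
  is `dG` by the Poincaré lemma on `V`, `∂̄G = (∂χ)^{0,1} = 0`, and `K = χ - G` has `∂K = 0`);
* `exists_ddbar_potential` — the local `∂∂̄`-lemma: a closed smooth `(1,1)`-form `α` is `∂∂̄ψ` on
  `V` for a function `ψ` smooth on `V` (`α = dη` by Poincaré, `η = η^{1,0} + η^{0,1}`,
  `η^{0,1} = ∂̄u` and `\overline{η^{1,0}} = ∂̄w` by the `∂̄`-Poincaré lemma on `V`
  (`isDolbeaultAcyclic_chartSet`), whence `α = ∂∂̄(u - w̄)`).

Voisin I, §2.3.3, Prop. 2.31, Prop. 2.36; Griffiths–Harris pp. 25, 387 (the local `∂∂̄`-lemma).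
Helper file for the reduction of the route item `LefschetzOneOneK3`.
-/

noncomputable section

open scoped Manifold ContDiff Topology ComplexConjugate
open Set Filter
open Literature.Geometry.Kaehler
open Literature.NumberTheory.Transcendental
open Literature.Analysis.Complex (typeProjAt typeProjAt_add typeProjAt_zero)

namespace Summit.HodgeConjecture.HodgeConjecture.Theorems

section Local

variable {E : Type} [NormedAddCommGroup E] [NormedSpace ℂ E] [FiniteDimensional ℂ E]
  {M : Type} [TopologicalSpace M] [ChartedSpace E M] [IsManifold 𝓘(ℂ, E) ω M]
  [IsManifold 𝓘(ℝ, E) ∞ M] [T2Space M]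

/-! ### Pointwise helpers -/

omit [FiniteDimensional ℂ E] [IsManifold 𝓘(ℂ, E) ω M] [IsManifold 𝓘(ℝ, E) ∞ M] [T2Space M] in
/-- Conjugation preserves smoothness at a point (cf. `…K3ZigzagLocal`). [cite: Wells1980, Ch. I §3] -/
theorem smoothAt_conj_form {k : ℕ} {α : MForm 𝓘(ℝ, E) M ℂ k} {x : M} (hα : α.SmoothAt x) :
    α.conj.SmoothAt x := by
  rw [MForm.SmoothAt, MForm.inChart_conj]
  exact ((ContinuousLinearMap.compContinuousAlternatingMapCLM ℝ E ℂ ℂ (Fin k)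
    (Complex.conjCLE : ℂ →L[ℝ] ℂ)).contDiff.of_le le_top).comp_contDiffWithinAt hα

/-- The type components of a form smooth at the points of an open set are smooth there
(localisation + the tree's `IsSmoothForm.typeComponent`). [cite: VoisinHodgeI2002, §2.3.1] -/
theorem smoothAt_typeComponent_of_isOpen {k : ℕ} {W : Set M} (hW : IsOpen W) {γ : MForm 𝓘(ℝ, E) M ℂ k}
    (hγ : ∀ z ∈ W, γ.SmoothAt z) (p q : ℕ) {x : M} (hx : x ∈ W) :
    (γ.typeComponent p q).SmoothAt x := by
  obtain ⟨β, hβs, hβ⟩ := exists_isSmoothForm_eventuallyEq hW hγ hx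
  exact ((isSmoothForm_iff_smoothAt _).1 (hβs.typeComponent p q) x).congr_of_eventuallyEq
    (typeComponent_eventuallyEq p q hβ)

omit [FiniteDimensional ℂ E] [IsManifold 𝓘(ℂ, E) ω M] [IsManifold 𝓘(ℝ, E) ∞ M] [T2Space M] in
/-- The type components at a point depend only on the value of the form at the point. [folklore] -/
theorem typeComponent_apply_congr_pt {k : ℕ} {γ γ' : MForm 𝓘(ℝ, E) M ℂ k} {x : M} (h : γ x = γ' x)
    (p q : ℕ) : γ.typeComponent p q x = γ'.typeComponent p q x := by
  rw [typeComponent_apply_eq_typeProjAt, typeComponent_apply_eq_typeProjAt]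
  exact congrArg (typeProjAt (E := E) p q) h

omit [FiniteDimensional ℂ E] [IsManifold 𝓘(ℂ, E) ω M] [IsManifold 𝓘(ℝ, E) ∞ M] [T2Space M] in
/-- Type components are additive, pointwise. [folklore] -/
theorem typeComponent_add_apply {k : ℕ} (γ γ' : MForm 𝓘(ℝ, E) M ℂ k) (p q : ℕ) (x : M) :
    (γ + γ').typeComponent p q x = γ.typeComponent p q x + γ'.typeComponent p q x := by
  rw [MForm.typeComponent_add]; rfl

omit [FiniteDimensional ℂ E] [IsManifold 𝓘(ℂ, E) ω M] [IsManifold 𝓘(ℝ, E) ∞ M] [T2Space M] in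
/-- Type components vanish where the form vanishes. [folklore] -/
theorem typeComponent_apply_eq_zero_of_apply_eq_zero {k : ℕ} {γ : MForm 𝓘(ℝ, E) M ℂ k} {x : M}
    (h : γ x = 0) (p q : ℕ) : γ.typeComponent p q x = 0 := by
  rw [typeComponent_apply_congr_pt (γ' := (0 : MForm 𝓘(ℝ, E) M ℂ k)) h p q, MForm.typeComponent_zero]
  rfl

omit [FiniteDimensional ℂ E] [T2Space M] in
/-- **`d` of a smooth form of type `(p,q)` has no components of other types**:
`(dβ)^{p',q'} = 0` unless `(p',q') ∈ {(p+1,q), (p,q+1)}` (`d = ∂ + ∂̄`).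
[cite: VoisinHodgeI2002, §2.3.3 Prop. 2.31] -/
theorem typeComponent_mextDeriv_eq_zero {k p q p' q' : ℕ} {β : MForm 𝓘(ℝ, E) M ℂ k}
    (hβs : IsSmoothForm β) (hβ : IsOfType p q β) (h1 : (p', q') ≠ (p + 1, q))
    (h2 : (p', q') ≠ (p, q + 1)) : (mextDeriv β).typeComponent p' q' = 0 := by
  have h := congrArg (MForm.typeComponent p' q') (hβs.mextDeriv_eq_typeComponent_add hβ)
  rw [MForm.typeComponent_add, typeComponent_typeComponent_holds, typeComponent_typeComponent_holds]
    at h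
  simp only [ne_eq, Prod.mk.injEq, not_and] at h1 h2
  rw [if_neg (fun h' ↦ h1 h'.1.symm h'.2.symm), if_neg (fun h' ↦ h2 h'.1.symm h'.2.symm),
    add_zero] at h
  exact h

omit [FiniteDimensional ℂ E] [IsManifold 𝓘(ℂ, E) ω M] [IsManifold 𝓘(ℝ, E) ∞ M] [T2Space M] in
/-- The value of a `0`-form as a function, and the identity `ofFun (value) = form`. [folklore] -/
theorem ofFun_apply_fin0 (u : MForm 𝓘(ℝ, E) M ℂ 0) :
    (MForm.ofFun 𝓘(ℝ, E) fun y ↦ u y ![]) = u := by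
  funext y; ext v
  rw [MForm.ofFun_apply]
  congr 1
  exact (Subsingleton.elim _ _)

/-! ### Pluriharmonic-type splitting: `∂∂̄χ = 0` ⇒ `χ = G + K` -/

/-- **A `∂∂̄`-closed function on a chart-convex set is holomorphic plus antiholomorphic.** If `χ`
is smooth at the points of `V = chartSet x₀ C` (`C` open convex inside the chart target) and
`∂∂̄χ = 0` on `V`, there are `G` holomorphic on `V` and `K` with `conj ∘ K` holomorphic on `V`
such that `χ = G + K` on `V`: the `(1,0)`-form `∂χ` is closed on `V` (`d∂χ = -∂∂̄χ = 0`), hence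
`dG` for a function `G` smooth on `V` (Poincaré lemma on chart-convex sets); `∂̄G = (∂χ)^{0,1} = 0`,
so `G` is holomorphic; and `K := χ - G` has `∂K = ∂χ - dG = 0`, so `conj ∘ K` is holomorphic.
[cite: VoisinHodgeI2002, §2.3.3] [cite: GriffithsHarris1978, p. 387] -/
theorem hol_add_antihol_of_ddbar_eq_zero (x₀ : M) {C : Set E} (hC : IsOpen C) (hCc : Convex ℝ C)
    (hCt : C ⊆ (chartAt E x₀).target) {χ : M → ℂ}
    (hχ : ∀ x ∈ chartSet 𝓘(ℝ, E) x₀ C, (MForm.ofFun 𝓘(ℝ, E) χ).SmoothAt x)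
    (h0 : ∀ x ∈ chartSet 𝓘(ℝ, E) x₀ C, dolbeault (dolbeaultBar (MForm.ofFun 𝓘(ℝ, E) χ)) x = 0) :
    ∃ G K : M → ℂ, MDifferentiableOn 𝓘(ℂ, E) 𝓘(ℂ, ℂ) G (chartSet 𝓘(ℝ, E) x₀ C) ∧
      MDifferentiableOn 𝓘(ℂ, E) 𝓘(ℂ, ℂ) (fun x ↦ conj (K x)) (chartSet 𝓘(ℝ, E) x₀ C) ∧
      ∀ x ∈ chartSet 𝓘(ℝ, E) x₀ C, χ x = G x + K x := by
  set V := chartSet 𝓘(ℝ, E) x₀ C with hVdef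
  have hV : IsOpen V := isOpen_chartSet 𝓘(ℝ, E) x₀ hC
  have hCt' : C ⊆ (extChartAt 𝓘(ℝ, E) x₀).target := by rw [extChartAt_self]; exact hCt
  -- the closed `(1,0)`-form `γ = ∂χ` on `V`
  set γ : MForm 𝓘(ℝ, E) M ℂ 1 := dolbeault (MForm.ofFun 𝓘(ℝ, E) χ) with hγ
  have hγs : ∀ x ∈ V, γ.SmoothAt x := fun x hx ↦ (mextDeriv_dolbeault_ofFun hV hχ hx).1
  have hγd : ∀ x ∈ V, mextDeriv γ x = 0 := fun x hx ↦ by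
    rw [(mextDeriv_dolbeault_ofFun hV hχ hx).2, h0 x hx, neg_zero]
  have hγc : γ.restr V ∈ localClosedForms 𝓘(ℝ, E) ℂ 1 V := by
    refine ⟨⟨fun x hx ↦ (MForm.smoothAt_restr_iff hV _ hx).2 (hγs x hx),
      fun x hx ↦ MForm.restr_apply_of_notMem _ hx⟩, fun x hx ↦ ?_⟩
    rw [mextDeriv_restr_apply hV _ hx, hγd x hx]
  -- Poincaré: `γ = dg` on `V`
  obtain ⟨g, hg⟩ := (mem_localExactForms_succ_iff hV).1
    (localClosedForms_chartSet_le_localExactForms (I := 𝓘(ℝ, E)) (F := ℂ) (k := 0) x₀ hC hCc hCt' hγc)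
  set G : M → ℂ := fun y ↦ (g : MForm 𝓘(ℝ, E) M ℂ 0) y ![] with hGdef
  have hGform : MForm.ofFun 𝓘(ℝ, E) G = (g : MForm 𝓘(ℝ, E) M ℂ 0) := ofFun_apply_fin0 _
  have hGs : ∀ x ∈ V, (MForm.ofFun 𝓘(ℝ, E) G).SmoothAt x := fun x hx ↦ by
    rw [hGform]; exact g.2.1 x hx
  have hdG : ∀ x ∈ V, mextDeriv (MForm.ofFun 𝓘(ℝ, E) G) x = γ x := fun x hx ↦ by
    have h := congrFun hg x
    rw [localD_apply_of_mem hV g hx, MForm.restr_apply_of_mem _ hx] at h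
    rw [hGform, h]
  -- `∂̄G = (∂χ)^{0,1} = 0`: `G` is holomorphic
  have hG0 : ∀ x ∈ V, dolbeaultBar (MForm.ofFun 𝓘(ℝ, E) G) x = 0 := fun x hx ↦ by
    rw [dolbeaultBar_zeroForm, typeComponent_apply_congr_pt (hdG x hx) 0 1]
    change ((dolbeault (MForm.ofFun 𝓘(ℝ, E) χ)).typeComponent 0 1) x = 0
    rw [dolbeault_zeroForm, typeComponent_typeComponent_holds]
    simp
  have hGhol : MDifferentiableOn 𝓘(ℂ, E) 𝓘(ℂ, ℂ) G V :=
    mdifferentiableOn_of_dolbeaultBar_ofFun_eq_zero hGs hG0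
  -- `K = χ - G` has `∂K = 0`: `conj ∘ K` is holomorphic
  set K : M → ℂ := fun y ↦ χ y - G y with hKdef
  have hKs : ∀ x ∈ V, (MForm.ofFun 𝓘(ℝ, E) K).SmoothAt x :=
    fun x hx ↦ (dolbeault_ofFun_sub hV hχ hGs hx).1
  have hK0 : ∀ x ∈ V, dolbeault (MForm.ofFun 𝓘(ℝ, E) K) x = 0 := fun x hx ↦ by
    rw [(dolbeault_ofFun_sub hV hχ hGs hx).2.1,
      dolbeault_ofFun_eq_mextDeriv_of_mdifferentiableOn hV hGhol hx, hdG x hx, hγ, sub_self]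
  have hKbar : ∀ x ∈ V, dolbeaultBar (MForm.ofFun 𝓘(ℝ, E) fun y ↦ conj (K y)) x = 0 := fun x hx ↦ by
    rw [ofFun_conj, dolbeaultBar_conj']
    change (Complex.conjCLE : ℂ →L[ℝ] ℂ).compContinuousAlternatingMap
      (dolbeault (MForm.ofFun 𝓘(ℝ, E) K) x) = 0
    rw [hK0 x hx]; ext v; simp
  have hKbs : ∀ x ∈ V, (MForm.ofFun 𝓘(ℝ, E) fun y ↦ conj (K y)).SmoothAt x := fun x hx ↦ by
    rw [ofFun_conj]; exact smoothAt_conj_form (hKs x hx)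
  refine ⟨G, K, hGhol, mdifferentiableOn_of_dolbeaultBar_ofFun_eq_zero hKbs hKbar, fun x _ ↦ ?_⟩
  simp [hKdef]

/-! ### The local `∂∂̄`-lemma -/

/-- **The local `∂∂̄`-lemma on a chart-convex set.** For a closed smooth `(1,1)`-form `α` on the
complex manifold `M` and `V = chartSet x₀ C` (`C` open convex inside the chart target), there is a
function `ψ`, smooth at the points of `V`, with `α = ∂∂̄ψ` on `V`: `α = dη` on `V` by the Poincaré
lemma; splitting `η = η^{1,0} + η^{0,1}`, the `(0,1)`-part is `∂̄`-closed on `V`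
(`(dη^{0,1})^{0,2} = α^{0,2} = 0`) hence `η^{0,1} = ∂̄u` on `V` by the `∂̄`-Poincaré lemma on
chart-convex sets, and likewise `\overline{η^{1,0}} = ∂̄w`, i.e. `η^{1,0} = ∂w̄`; then
`α = d(∂w̄ + ∂̄u) = ∂∂̄(u - w̄)`. [cite: VoisinHodgeI2002, Prop. 2.36 and §2.3.3]
[cite: GriffithsHarris1978, p. 387] -/
theorem exists_ddbar_potential (x₀ : M) {C : Set E} (hC : IsOpen C) (hCc : Convex ℝ C)
    (hCt : C ⊆ (chartAt E x₀).target) {α : MForm 𝓘(ℝ, E) M ℂ 2} (hs : IsSmoothForm α)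
    (hc : IsClosedForm α) (h11 : IsOfType 1 1 α) :
    ∃ ψ : M → ℂ, (∀ x ∈ chartSet 𝓘(ℝ, E) x₀ C, (MForm.ofFun 𝓘(ℝ, E) ψ).SmoothAt x) ∧
      ∀ x ∈ chartSet 𝓘(ℝ, E) x₀ C,
        dolbeault (dolbeaultBar (MForm.ofFun 𝓘(ℝ, E) ψ)) x = α x := by
  set V := chartSet 𝓘(ℝ, E) x₀ C with hVdef
  have hV : IsOpen V := isOpen_chartSet 𝓘(ℝ, E) x₀ hC
  have hCt' : C ⊆ (extChartAt 𝓘(ℝ, E) x₀).target := by rw [extChartAt_self]; exact hCt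
  have hacyc : IsDolbeaultAcyclic E M hV 0 := isDolbeaultAcyclic_chartSet x₀ hC hCc hCt 0
  -- Poincaré: `α = dη` on `V`
  have hαc : α.restr V ∈ localClosedForms 𝓘(ℝ, E) ℂ 2 V := by
    refine ⟨⟨fun x hx ↦ (MForm.smoothAt_restr_iff hV _ hx).2 (hs x),
      fun x hx ↦ MForm.restr_apply_of_notMem _ hx⟩, fun x hx ↦ ?_⟩
    rw [mextDeriv_restr_apply hV _ hx]
    exact congrFun hc x
  obtain ⟨η, hη⟩ := (mem_localExactForms_succ_iff hV).1
    (localClosedForms_chartSet_le_localExactForms (I := 𝓘(ℝ, E)) (F := ℂ) (k := 1) x₀ hC hCc hCt' hαc)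
  have hηs : ∀ x ∈ V, (η : MForm 𝓘(ℝ, E) M ℂ 1).SmoothAt x := η.2.1
  have hdη : ∀ x ∈ V, mextDeriv (η : MForm 𝓘(ℝ, E) M ℂ 1) x = α x := fun x hx ↦ by
    have h := congrFun hη x
    rwa [localD_apply_of_mem hV η hx, MForm.restr_apply_of_mem _ hx] at h
  -- the type components `η^{1,0}`, `η^{0,1}` as forms on `V`
  set η10 : MForm 𝓘(ℝ, E) M ℂ 1 := (η : MForm 𝓘(ℝ, E) M ℂ 1).typeComponent 1 0 with hη10
  set η01 : MForm 𝓘(ℝ, E) M ℂ 1 := (η : MForm 𝓘(ℝ, E) M ℂ 1).typeComponent 0 1 with hη01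
  have hη10t : IsOfType 1 0 η10 := isOfType_typeComponent_holds (p := 1) (q := 0) rfl _
  have hη01t : IsOfType 0 1 η01 := isOfType_typeComponent_holds (p := 0) (q := 1) rfl _
  have h10s : ∀ x ∈ V, η10.SmoothAt x := fun x hx ↦ smoothAt_typeComponent_of_isOpen hV hηs 1 0 hx
  have h01s : ∀ x ∈ V, η01.SmoothAt x := fun x hx ↦ smoothAt_typeComponent_of_isOpen hV hηs 0 1 hx
  have h10z : ∀ x ∉ V, η10 x = 0 := fun x hx ↦
    typeComponent_apply_eq_zero_of_apply_eq_zero (η.2.2 x hx) 1 0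
  have h01z : ∀ x ∉ V, η01 x = 0 := fun x hx ↦
    typeComponent_apply_eq_zero_of_apply_eq_zero (η.2.2 x hx) 0 1
  have hsum : (η : MForm 𝓘(ℝ, E) M ℂ 1) = η10 + η01 := by
    funext x; rw [Pi.add_apply]; exact apply_eq_typeComponent_add _ x
  -- localise `η` near a point of `V`: types of `dη^{1,0}`, `dη^{0,1}`
  have hvan : ∀ x ∈ V, (mextDeriv η01).typeComponent 0 2 x = 0 ∧
      (mextDeriv η10).typeComponent 2 0 x = 0 := by
    intro x hx
    obtain ⟨β, hβs, hβ⟩ := exists_isSmoothForm_eventuallyEq hV hηs hx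
    have hβ10 : ∀ᶠ z in 𝓝 x, β.typeComponent 1 0 z = η10 z := typeComponent_eventuallyEq 1 0 hβ
    have hβ01 : ∀ᶠ z in 𝓝 x, β.typeComponent 0 1 z = η01 z := typeComponent_eventuallyEq 0 1 hβ
    -- `dη = dη10 + dη01` at `x`, and `(dη)^{0,2} = α^{0,2} = 0`, `(dη)^{2,0} = α^{2,0} = 0` there
    have hd : mextDeriv (η : MForm 𝓘(ℝ, E) M ℂ 1) x = (mextDeriv η10 + mextDeriv η01) x := by
      conv_lhs => rw [hsum]
      exact mextDeriv_add_apply (h10s x hx) (h01s x hx)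
    have hα02 : α.typeComponent 0 2 x = 0 := by
      rw [IsOfType.typeComponent_of_ne_holds h11 (Or.inl (by norm_num))]; rfl
    have hα20 : α.typeComponent 2 0 x = 0 := by
      rw [IsOfType.typeComponent_of_ne_holds h11 (Or.inl (by norm_num))]; rfl
    have h10van : (mextDeriv η10).typeComponent 0 2 x = 0 := by
      rw [typeComponent_apply_congr_pt (mextDeriv_congr_of_eventuallyEq hβ10).symm 0 2,
        typeComponent_mextDeriv_eq_zero (hβs.typeComponent 1 0)
          (isOfType_typeComponent_holds (p := 1) (q := 0) rfl β) (by decide) (by decide)]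
      rfl
    have h01van : (mextDeriv η01).typeComponent 2 0 x = 0 := by
      rw [typeComponent_apply_congr_pt (mextDeriv_congr_of_eventuallyEq hβ01).symm 2 0,
        typeComponent_mextDeriv_eq_zero (hβs.typeComponent 0 1)
          (isOfType_typeComponent_holds (p := 0) (q := 1) rfl β) (by decide) (by decide)]
      rfl
    have hdη02 : (mextDeriv (η : MForm 𝓘(ℝ, E) M ℂ 1)).typeComponent 0 2 x = 0 := by
      rw [typeComponent_apply_congr_pt (hdη x hx) 0 2, hα02]
    have hdη20 : (mextDeriv (η : MForm 𝓘(ℝ, E) M ℂ 1)).typeComponent 2 0 x = 0 := by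
      rw [typeComponent_apply_congr_pt (hdη x hx) 2 0, hα20]
    rw [typeComponent_apply_congr_pt hd, typeComponent_add_apply, h10van, zero_add] at hdη02
    rw [typeComponent_apply_congr_pt hd, typeComponent_add_apply, h01van, add_zero] at hdη20
    exact ⟨hdη02, hdη20⟩
  -- `η^{0,1}` is `∂̄`-closed on `V`, hence `∂̄u`
  have h01mem : η01 ∈ pqFormsOn E M V 0 1 := ⟨h01s, h01z, hη01t⟩
  have h01closed : localDbar E M hV 0 1 ⟨η01, h01mem⟩ = 0 := by
    refine Subtype.ext (funext fun x ↦ ?_)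
    rw [coe_localDbar, ZeroMemClass.coe_zero, Pi.zero_apply]
    by_cases hx : x ∈ V
    · rw [MForm.restr_apply_of_mem _ hx]
      change dolbeaultBar η01 x = 0
      rw [IsOfType.dolbeaultBar_eq_holds hη01t]
      exact (hvan x hx).1
    · exact MForm.restr_apply_of_notMem _ hx
  obtain ⟨u, hu⟩ := hacyc 0 ⟨η01, h01mem⟩ h01closed
  -- `conj η^{1,0}` is `∂̄`-closed on `V`, hence `∂̄w`
  have h10cmem : η10.conj ∈ pqFormsOn E M V 0 1 :=
    ⟨fun x hx ↦ smoothAt_conj_form (h10s x hx), fun x hx ↦ by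
      change (Complex.conjCLE : ℂ →L[ℝ] ℂ).compContinuousAlternatingMap (η10 x) = 0
      rw [h10z x hx]; ext v; simp, hη10t.conj⟩
  have h10closed : localDbar E M hV 0 1 ⟨η10.conj, h10cmem⟩ = 0 := by
    refine Subtype.ext (funext fun x ↦ ?_)
    rw [coe_localDbar, ZeroMemClass.coe_zero, Pi.zero_apply]
    by_cases hx : x ∈ V
    · rw [MForm.restr_apply_of_mem _ hx]
      change dolbeaultBar η10.conj x = 0
      rw [dolbeaultBar_conj']
      change (Complex.conjCLE : ℂ →L[ℝ] ℂ).compContinuousAlternatingMap (dolbeault η10 x) = 0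
      rw [IsOfType.dolbeault_eq_holds hη10t]
      rw [(hvan x hx).2]; ext v; simp
    · exact MForm.restr_apply_of_notMem _ hx
  obtain ⟨w, hw⟩ := hacyc 0 ⟨η10.conj, h10cmem⟩ h10closed
  -- the potentials as functions
  set uf : M → ℂ := fun y ↦ (u : MForm 𝓘(ℝ, E) M ℂ (0 + 0)) y ![] with huf
  set vf : M → ℂ := fun y ↦ conj ((w : MForm 𝓘(ℝ, E) M ℂ (0 + 0)) y ![]) with hvf
  have huform : MForm.ofFun 𝓘(ℝ, E) uf = (u : MForm 𝓘(ℝ, E) M ℂ (0 + 0)) := ofFun_apply_fin0 _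
  have hvform : MForm.ofFun 𝓘(ℝ, E) vf = (w : MForm 𝓘(ℝ, E) M ℂ (0 + 0)).conj := by
    rw [hvf, ofFun_conj, ofFun_apply_fin0]
  have hus : ∀ x ∈ V, (MForm.ofFun 𝓘(ℝ, E) uf).SmoothAt x := fun x hx ↦ by
    rw [huform]; exact u.2.1 x hx
  have hvs : ∀ x ∈ V, (MForm.ofFun 𝓘(ℝ, E) vf).SmoothAt x := fun x hx ↦ by
    rw [hvform]; exact smoothAt_conj_form (w.2.1 x hx)
  -- `∂̄u = η01` and `∂v̄ = η10` on `V`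
  have hdu : ∀ x ∈ V, dolbeaultBar (MForm.ofFun 𝓘(ℝ, E) uf) x = η01 x := fun x hx ↦ by
    have h := congrArg (fun γ : ↥(pqFormsOn E M V 0 (0 + 1)) ↦ (γ : MForm 𝓘(ℝ, E) M ℂ (0 + (0 + 1))) x) hu
    simp only [coe_localDbar, MForm.restr_apply_of_mem _ hx] at h
    rw [huform]; exact h
  have hdv : ∀ x ∈ V, dolbeault (MForm.ofFun 𝓘(ℝ, E) vf) x = η10 x := fun x hx ↦ by
    have h := congrArg (fun γ : ↥(pqFormsOn E M V 0 (0 + 1)) ↦ (γ : MForm 𝓘(ℝ, E) M ℂ (0 + (0 + 1))) x) hw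
    simp only [coe_localDbar, MForm.restr_apply_of_mem _ hx] at h
    rw [hvform, dolbeault_conj']
    change (Complex.conjCLE : ℂ →L[ℝ] ℂ).compContinuousAlternatingMap
      (dolbeaultBar (w : MForm 𝓘(ℝ, E) M ℂ (0 + 0)) x) = η10 x
    rw [h]
    change ((η10.conj).conj) x = η10 x
    rw [conj_conj_form]
  -- the potential `ψ = u - v̄` : `∂∂̄ψ = d(∂v̄ + ∂̄u) = dη = α` on `V`
  refine ⟨fun y ↦ uf y - vf y, fun x hx ↦ (dolbeault_ofFun_sub hV hus hvs hx).1, fun x hx ↦ ?_⟩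
  rw [(dolbeault_ofFun_sub hV hus hvs hx).2.2, ← hdη x hx]
  -- localise `u`, `v` near `x` to global smooth `0`-forms
  obtain ⟨U, hUs, hU⟩ := exists_isSmoothForm_eventuallyEq hV hus hx
  obtain ⟨W, hWs, hW⟩ := exists_isSmoothForm_eventuallyEq hV hvs hx
  have hηev : ∀ᶠ z in 𝓝 x, (dolbeault W + dolbeaultBar U) z = (η : MForm 𝓘(ℝ, E) M ℂ 1) z := by
    have h1 := dolbeault_eventuallyEq_of_eventuallyEq hW
    have h2 := dolbeaultBar_eventuallyEq_of_eventuallyEq hU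
    filter_upwards [h1, h2, hV.mem_nhds hx] with z hz1 hz2 hzV
    rw [Pi.add_apply, hz1, hz2, hdv z hzV, hdu z hzV, hsum, Pi.add_apply]
  rw [← mextDeriv_congr_of_eventuallyEq hηev,
    mextDeriv_add (isSmoothForm_dolbeault' hWs) (isSmoothForm_dolbeaultBar' hUs), Pi.add_apply,
    mextDeriv_dolbeault_of_isSmoothForm hWs, Pi.neg_apply,
    mextDeriv_eq_dolbeault_add_dolbeaultBar_holds (isSmoothForm_dolbeaultBar' hUs), Pi.add_apply,
    dolbeaultBar_dolbeaultBar_holds hUs, Pi.zero_apply, add_zero,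
    dolbeault_congr_of_eventuallyEq (dolbeaultBar_eventuallyEq_of_eventuallyEq hU),
    dolbeault_congr_of_eventuallyEq (dolbeaultBar_eventuallyEq_of_eventuallyEq hW)]
  abel

end Local

end Summit.HodgeConjecture.HodgeConjecture.Theorems

end
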